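import Summits.CriticalPhenomena.SAWScalingLimit.Theses.SAWQuarterTwist

/-!
# Crux `BulkScalingLimitExists` (stmt-CriticalPhenomena-16651) — typed decomposition
# `RatioPrecompact → LimitIdentification → BulkScalingLimitExists`

Crux-strategist workfile (seat `planner-cstrat-stmt-CriticalPhenomena-16651-b1-0`, 2026-08-17), written in the shape
`Sub₁ → Sub₂ → Crux` for a possible `ledger route edit --split BulkScalingLimitExists --into RatioPrecompact
LimitIdentification --glue 'BulkScalingLimitExists_of_subs'` by the tenure planner (see `DECOMPOSITION.md` and
`STRATEGY-CENSUS.md` in this directory).  SORRY-FREE; the only axioms are the standard three.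

The crux (the normaliser `n_δ` is free, so its content is the convergence of the RATIOS
`R_δ(ψ) = ⟨ψ, F_δ⟩ / ⟨ψ₀, F_δ⟩` of smeared pairings of the quarter-twisted interior-source SAW parafermion, refuter
R2-review) is the conjunction of two pieces of different nature, neither of which is the crux or the summit:

* `Sub₁ = RatioPrecompact` — the REGULARITY half (the a-priori input named in the crux's why-might-fail and in the
  barrier `Literature.Barriers.CriticalPhenomena.ParafermionicHalfCauchyRiemann`, in its weakest smeared form): for
  admissible data there is a bulk test function `ψ₀` (an ANCHOR: eventually non-vanishing pairing dominating every
  bulk pairing) such that along EVERY sequence of meshes `u k → 0⁺` a subsequence of the normalised pairings converges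
  on all bulk test functions simultaneously.  (= the registered stubs S1 `stub_dominantAnchor` ∧ S2
  `stub_weakStarExtraction` of `Lines/birth.lean` merged; S2 is deterministic functional analysis, so `Sub₁` is S1 in
  content.)  This is `B⁻`, "subsequential bulk scaling limits exist and are non-degenerate".
* `Sub₂ = LimitIdentification` — the IDENTIFICATION half (verbatim S3 of `Lines/birth.lean`): two sequential limit
  functionals of the `ψ₀`-normalised pairings coincide on bulk test functions.

`crux ⟹ Sub₁ ∧ Sub₂` (convergent ratios are bounded with an eventually non-vanishing denominator and have one
cluster value; `Lines/birth.md`), and `Sub₁ → Sub₂ → crux` is `BulkScalingLimitExists_of_subs` below (the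
subsequence principle on the countably generated filter `𝓝[>] 0`, `Filter.tendsto_of_subseq_tendsto`; normaliser
`n_δ := (δ² ⟨ψ₀, F_δ⟩)⁻¹`, `ℓ ψ₀ = 1`).

WHY FILE THE SPLIT (strategist census, `STRATEGY-CENSUS.md` §Decomposition): the identification half `Sub₂` has NO
lattice input for the twisted bulk observable — its boundary values mix the winding sectors `w` around the source with
the non-real phases `(e^{-2πiσ} u)^w = e^{-3πi w/4}` (exactness forces `u² = −1`, Riemann–Hilbert reality would need
`u = ± e^{2πiσ}`, i.e. `u² = i`; compatible only at `σ = 1/2`), so no Riemann–Hilbert boundary condition of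
Smirnov / Hongler–Smirnov type exists, and the interior data the lattice does give (holomorphy off `p ∪ cut`, jump `u`,
local universality at `p`) leave the family `c (z−p)^{-5/4} + (z−p)^{-1/4}·𝒪(Ω)` undetermined.  `Sub₂` therefore
duplicates the burden of the route's crux `BulkToBoundary`; the recommended re-cut is to let `closes` consume `Sub₁`
(= `B⁻`) in place of `BulkScalingLimitExists` once `BulkToBoundary` is re-typed over `(TwistedPropagatorLaw, B⁻)`.

§1 is the crux's three `let`s VERBATIM as definitions plus the pairing vocabulary (copied from `Lines/birth.lean` §1 so
that `bulkScalingLimitExists_iff` stays `Iff.rfl`); §2 the two pieces; §3 the proved assembly.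
-/

noncomputable section

-- the route file's scopes, re-opened verbatim so that elaboration (instances of the `if`s, coercions)
-- coincides with the crux's and `bulkScalingLimitExists_iff` below is `Iff.rfl`
open scoped BigOperators Topology Manifold Classical MeasureTheory ProbabilityTheory Matrix InnerProductSpace ComplexConjugate ContinuousMap
open Filter Set Function TopologicalSpace MeasureTheory
open Literature.Probability.RandomPlanarGeometry Literature.Probability.LatticeModels

namespace Summit.CriticalPhenomena.SAWScalingLimit.Cruxes.BulkScalingLimitExists.Strategist

/-! ### 1. Vocabulary — the crux's three `let`s as definitions, pairings, ratios, admissibility (as in `Lines/birth.lean`) -/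

/-- The cut sign `sgn_s(p, q) ∈ {1, −1, 0}` of a directed lattice step `p → q` (VERBATIM the crux's `let sgn`). -/
def sgn (x : ℝ → Site 2) : ℝ → HexVertex → HexVertex → ℤ := fun s p q =>
  if q.2 = 0 ∧ p.2 = 1 ∧ p.1 = q.1 - Pi.single 1 1 ∧ q.1 1 = x s 1 ∧ x s 0 ≤ q.1 0 then 1
  else if p.2 = 0 ∧ q.2 = 1 ∧ q.1 = p.1 - Pi.single 1 1 ∧ p.1 1 = x s 1 ∧ x s 0 ≤ p.1 0 then -1 else 0

/-- The source mid-edge `a s`: the left vertical side of the hexagon at the cell `x s` (VERBATIM the crux's `let a`). -/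
def src (x : ℝ → Site 2) : ℝ → Sym2 HexVertex := fun s =>
  s((x s - Pi.single 0 1, (0 : Fin 2)), (x s - Pi.single 0 1 - Pi.single 1 1, (1 : Fin 2)))

/-- The quarter-twisted interior-source parafermion `F^tw_s(z)` (VERBATIM the crux's `let F`). -/
def Ftw (Λ : ℝ → Finset HexVertex) (x : ℝ → Site 2) : ℝ → Sym2 HexVertex → ℂ := fun s z =>
  ∑ γ : Literature.Probability.RandomPlanarGeometry.SAW.HexMidEdgeSAW (Λ s) (src x s) z,
    γ.weight Literature.Probability.RandomPlanarGeometry.SAW.hexCriticalFugacity (5 / 8) *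
      Complex.I ^ ((γ.verts.zip γ.verts.tail).map (fun pq => sgn x s pq.1 pq.2)).sum

/-- The smeared pairing `⟨ψ, F_δ⟩ := Σ_{e ∈ midEdges Λ_δ} ψ(δ · mid e) F^tw_δ(e)` (without the factor `δ²`). -/
def pairing (Λ : ℝ → Finset HexVertex) (x : ℝ → Site 2) (ψ : ℂ → ℂ) (δ : ℝ) : ℂ :=
  ∑ᶠ e ∈ Literature.Probability.RandomPlanarGeometry.SAW.hexDomainMidEdges (Λ δ),
    ψ ((δ : ℂ) * Literature.Probability.RandomPlanarGeometry.SAW.hexMidpoint e) * Ftw Λ x δ e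

/-- The self-normalised ratio `R_δ(ψ) = ⟨ψ, F_δ⟩ / ⟨ψ₀, F_δ⟩` (junk value `0` at a zero denominator). -/
def ratio (Λ : ℝ → Finset HexVertex) (x : ℝ → Site 2) (ψ₀ ψ : ℂ → ℂ) (δ : ℝ) : ℂ :=
  pairing Λ x ψ δ / pairing Λ x ψ₀ δ

/-- Bulk test functions of `(Ω, p)`: `ψ ∈ C_c(Ω ∖ {p})`. -/
def IsBulkTest (D : DobrushinDomain) (p : ℂ) (ψ : ℂ → ℂ) : Prop :=
  Continuous ψ ∧ HasCompactSupport ψ ∧ tsupport ψ ⊆ D.carrier \ {p}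

/-- Admissible data `(D, p, ρ, Λ, x)`: the conjunction of the crux's six hypotheses, VERBATIM. -/
def Admissible (D : DobrushinDomain) (p : ℂ) (ρ : ℝ) (Λ : ℝ → Finset HexVertex) (x : ℝ → Site 2) : Prop :=
  p ∈ D.carrier ∧ 0 < ρ ∧ Metric.ball p ρ ⊆ D.carrier ∧
  (∀ᶠ δ : ℝ in nhdsWithin 0 (Set.Ioi 0),
    Literature.Probability.RandomPlanarGeometry.SAW.hexDomainSimplyConnected (Λ δ) ∧
    (hexGraph.induce ((Λ δ : Finset HexVertex) : Set HexVertex)).Preconnected ∧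
    (∀ v ∈ Λ δ, (δ : ℂ) * hexCenter v ∈ D.carrier) ∧
    (∀ v : HexVertex, (δ : ℂ) * hexCenter v ∈ Metric.ball p ρ → v ∈ Λ δ)) ∧
  (∀ K : Set ℂ, IsCompact K → K ⊆ D.carrier → ∀ᶠ δ : ℝ in nhdsWithin 0 (Set.Ioi 0),
    ∀ v : HexVertex, (δ : ℂ) * hexCenter v ∈ K → v ∈ Λ δ) ∧
  Filter.Tendsto (fun δ : ℝ => (δ : ℂ) * triEmbed (x δ)) (nhdsWithin 0 (Set.Ioi 0)) (nhds p)

/-- An ANCHOR for `(D, p, Λ, x)`: a bulk test function `ψ₀` whose pairing is eventually non-zero and dominates every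
bulk pairing eventually. -/
def IsAnchor (D : DobrushinDomain) (p : ℂ) (Λ : ℝ → Finset HexVertex) (x : ℝ → Site 2) (ψ₀ : ℂ → ℂ) :
    Prop :=
  IsBulkTest D p ψ₀ ∧ (∀ᶠ δ : ℝ in nhdsWithin 0 (Set.Ioi 0), pairing Λ x ψ₀ δ ≠ 0) ∧
  ∀ ψ : ℂ → ℂ, IsBulkTest D p ψ → ∃ C : ℝ, ∀ᶠ δ : ℝ in nhdsWithin 0 (Set.Ioi 0),
    ‖pairing Λ x ψ δ‖ ≤ C * ‖pairing Λ x ψ₀ δ‖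

/-- Sequential weak-* convergence of the `ψ₀`-normalised pairings along a sequence `u` of meshes to the functional `L`,
tested on bulk test functions. -/
def SeqLimit (D : DobrushinDomain) (p : ℂ) (Λ : ℝ → Finset HexVertex) (x : ℝ → Site 2) (ψ₀ : ℂ → ℂ)
    (u : ℕ → ℝ) (L : (ℂ → ℂ) → ℂ) : Prop :=
  ∀ ψ : ℂ → ℂ, IsBulkTest D p ψ → Filter.Tendsto (fun k => ratio Λ x ψ₀ ψ (u k)) Filter.atTop (nhds (L ψ))

/-! ### 2. The two pieces -/

/-- **`Sub₁ = RatioPrecompact` (`B⁻`, the regularity half):** for admissible data there is an anchor `ψ₀` such that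
along every sequence of meshes `u k → 0⁺` some subsequence of the `ψ₀`-normalised pairings converges on every bulk test
function simultaneously.  Conjecture-grade (the a-priori / non-cancellation input of the half-Cauchy–Riemann barrier,
cancellation factor `δ^{17/24}` expected); strictly weaker than the crux. -/
def RatioPrecompact : Prop :=
  ∀ (D : DobrushinDomain) (p : ℂ) (ρ : ℝ) (Λ : ℝ → Finset HexVertex) (x : ℝ → Site 2),
    Admissible D p ρ Λ x → ∃ ψ₀ : ℂ → ℂ, IsAnchor D p Λ x ψ₀ ∧
      ∀ u : ℕ → ℝ, Filter.Tendsto u Filter.atTop (nhdsWithin 0 (Set.Ioi 0)) →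
        ∃ φ : ℕ → ℕ, StrictMono φ ∧ ∃ L : (ℂ → ℂ) → ℂ, SeqLimit D p Λ x ψ₀ (u ∘ φ) L

/-- **`Sub₂ = LimitIdentification` (the identification half, verbatim S3 of `Lines/birth.lean`):** for admissible data
and an anchor, any two sequential limits of the normalised pairings agree on bulk test functions.  Conjecture-grade;
strictly weaker than the crux; NO lattice boundary condition is available for it (census §Transfer/§Negation). -/
def LimitIdentification : Prop :=
  ∀ (D : DobrushinDomain) (p : ℂ) (ρ : ℝ) (Λ : ℝ → Finset HexVertex) (x : ℝ → Site 2),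
    Admissible D p ρ Λ x → ∀ ψ₀ : ℂ → ℂ, IsAnchor D p Λ x ψ₀ →
      ∀ (u u' : ℕ → ℝ) (L L' : (ℂ → ℂ) → ℂ),
        Filter.Tendsto u Filter.atTop (nhdsWithin 0 (Set.Ioi 0)) →
        Filter.Tendsto u' Filter.atTop (nhdsWithin 0 (Set.Ioi 0)) →
        SeqLimit D p Λ x ψ₀ u L → SeqLimit D p Λ x ψ₀ u' L' →
          ∀ ψ : ℂ → ℂ, IsBulkTest D p ψ → L ψ = L' ψ

/-- The crux with its three `let`s delta-reduced into the §1 vocabulary. -/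
def BulkScalingLimitExists' : Prop :=
  ∀ (D : DobrushinDomain) (p : ℂ) (ρ : ℝ) (Λ : ℝ → Finset HexVertex) (x : ℝ → Site 2),
    p ∈ D.carrier → 0 < ρ → Metric.ball p ρ ⊆ D.carrier →
    (∀ᶠ δ : ℝ in nhdsWithin 0 (Set.Ioi 0),
      Literature.Probability.RandomPlanarGeometry.SAW.hexDomainSimplyConnected (Λ δ) ∧
      (hexGraph.induce ((Λ δ : Finset HexVertex) : Set HexVertex)).Preconnected ∧
      (∀ v ∈ Λ δ, (δ : ℂ) * hexCenter v ∈ D.carrier) ∧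
      (∀ v : HexVertex, (δ : ℂ) * hexCenter v ∈ Metric.ball p ρ → v ∈ Λ δ)) →
    (∀ K : Set ℂ, IsCompact K → K ⊆ D.carrier → ∀ᶠ δ : ℝ in nhdsWithin 0 (Set.Ioi 0),
      ∀ v : HexVertex, (δ : ℂ) * hexCenter v ∈ K → v ∈ Λ δ) →
    Filter.Tendsto (fun δ : ℝ => (δ : ℂ) * triEmbed (x δ)) (nhdsWithin 0 (Set.Ioi 0)) (nhds p) →
    ∃ (n : ℝ → ℂ) (ℓ : (ℂ → ℂ) → ℂ),
      (∃ ψ₀ : ℂ → ℂ, Continuous ψ₀ ∧ HasCompactSupport ψ₀ ∧ tsupport ψ₀ ⊆ D.carrier \ {p} ∧ ℓ ψ₀ ≠ 0) ∧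
      ∀ ψ : ℂ → ℂ, Continuous ψ → HasCompactSupport ψ → tsupport ψ ⊆ D.carrier \ {p} →
        Filter.Tendsto (fun δ : ℝ => n δ * (δ : ℂ) ^ 2 *
          ∑ᶠ e ∈ Literature.Probability.RandomPlanarGeometry.SAW.hexDomainMidEdges (Λ δ),
            ψ ((δ : ℂ) * Literature.Probability.RandomPlanarGeometry.SAW.hexMidpoint e) * Ftw Λ x δ e)
          (nhdsWithin 0 (Set.Ioi 0)) (nhds (ℓ ψ))

/-- The primed form IS the route decl (delta/zeta reduction). -/
theorem bulkScalingLimitExists_iff :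
    BulkScalingLimitExists' ↔
      Summit.CriticalPhenomena.SAWScalingLimit.Theses.SAWQuarterTwist.BulkScalingLimitExists :=
  Iff.rfl

/-! ### 3. The assembly (no `sorry`) -/

/-- The reference sequence of meshes `δ_k = 1/(k+1) → 0⁺`. -/
theorem tendsto_refSeq :
    Filter.Tendsto (fun k : ℕ => 1 / ((k : ℝ) + 1)) Filter.atTop (nhdsWithin 0 (Set.Ioi 0)) := by
  refine tendsto_nhdsWithin_iff.2 ⟨tendsto_one_div_add_atTop_nhds_zero_nat, ?_⟩
  exact Filter.Eventually.of_forall fun k => by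
    show (0 : ℝ) < 1 / ((k : ℝ) + 1)
    positivity

/-- Along an anchor, the self-ratio `R_δ(ψ₀)` tends to `1` on every sequence of meshes `u k → 0⁺`. -/
theorem tendsto_ratio_self {D : DobrushinDomain} {p : ℂ} {Λ : ℝ → Finset HexVertex} {x : ℝ → Site 2}
    {ψ₀ : ℂ → ℂ} (hA : IsAnchor D p Λ x ψ₀) {u : ℕ → ℝ}
    (hu : Filter.Tendsto u Filter.atTop (nhdsWithin 0 (Set.Ioi 0))) :
    Filter.Tendsto (fun k => ratio Λ x ψ₀ ψ₀ (u k)) Filter.atTop (nhds 1) := by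
  have hev : ∀ᶠ k in Filter.atTop, ratio Λ x ψ₀ ψ₀ (u k) = 1 :=
    (hu.eventually hA.2.1).mono fun k hk => div_self hk
  exact tendsto_const_nhds.congr' (hev.mono fun k hk => hk.symm)

/-- **The assembly in the delta-reduced form**: `RatioPrecompact → LimitIdentification → BulkScalingLimitExists'`. -/
theorem bulkScalingLimitExists'_of_subs (h1 : RatioPrecompact) (h3 : LimitIdentification) :
    BulkScalingLimitExists' := by
  intro D p ρ Λ x hp hρ hball hΛ hK hx
  have hAdm : Admissible D p ρ Λ x := ⟨hp, hρ, hball, hΛ, hK, hx⟩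
  -- Sub₁: an anchor together with sequential extraction
  obtain ⟨ψ₀, hA, hext⟩ := h1 D p ρ Λ x hAdm
  -- extraction along the reference sequence: the candidate limit functional `L`
  obtain ⟨φ₀, hφ₀, L, hL⟩ := hext _ tendsto_refSeq
  have hu₀ : Filter.Tendsto ((fun k : ℕ => 1 / ((k : ℝ) + 1)) ∘ φ₀) Filter.atTop
      (nhdsWithin 0 (Set.Ioi 0)) :=
    tendsto_refSeq.comp hφ₀.tendsto_atTop
  refine ⟨fun δ => ((δ : ℂ) ^ 2 * pairing Λ x ψ₀ δ)⁻¹, L, ⟨ψ₀, hA.1.1, hA.1.2.1, hA.1.2.2, ?_⟩, ?_⟩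
  · -- `L ψ₀ = 1`
    have h1' : Filter.Tendsto (fun k => ratio Λ x ψ₀ ψ₀ (((fun k : ℕ => 1 / ((k : ℝ) + 1)) ∘ φ₀) k))
        Filter.atTop (nhds (L ψ₀)) := hL ψ₀ hA.1
    have hone := tendsto_ratio_self hA hu₀
    rw [tendsto_nhds_unique h1' hone]
    exact one_ne_zero
  · intro ψ hψc hψs hψt
    have hψ : IsBulkTest D p ψ := ⟨hψc, hψs, hψt⟩
    -- every sequence of meshes has a subsequence along which `R(ψ) → L ψ`
    have key : Filter.Tendsto (fun δ => ratio Λ x ψ₀ ψ δ) (nhdsWithin 0 (Set.Ioi 0)) (nhds (L ψ)) := by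
      refine Filter.tendsto_of_subseq_tendsto fun u hu => ?_
      obtain ⟨φ, hφ, L', hL'⟩ := hext u hu
      have hEq : L ψ = L' ψ :=
        h3 D p ρ Λ x hAdm ψ₀ hA _ _ L L' hu₀ (hu.comp hφ.tendsto_atTop) hL hL' ψ hψ
      exact ⟨φ, by rw [hEq]; exact hL' ψ hψ⟩
    -- and the normalised pairing IS the ratio for `δ > 0`
    refine key.congr' ?_
    have hpos : ∀ᶠ δ in nhdsWithin (0 : ℝ) (Set.Ioi 0), (0 : ℝ) < δ :=
      eventually_mem_nhdsWithin.mono fun δ hδ => hδ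
    filter_upwards [hpos] with δ hδ
    have hδ2 : (δ : ℂ) ^ 2 ≠ 0 := pow_ne_zero _ (Complex.ofReal_ne_zero.mpr hδ.ne')
    show pairing Λ x ψ δ / pairing Λ x ψ₀ δ =
      ((δ : ℂ) ^ 2 * pairing Λ x ψ₀ δ)⁻¹ * (δ : ℂ) ^ 2 * pairing Λ x ψ δ
    rw [mul_inv, mul_right_comm ((δ : ℂ) ^ 2)⁻¹, inv_mul_cancel₀ hδ2, one_mul, ← div_eq_inv_mul]

/-- **`BulkScalingLimitExists_of_subs`** (kernel-checked, no `sorry`): the two pieces imply the route decl BY NAME.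
This is the glue for `ledger route edit --split BulkScalingLimitExists --into RatioPrecompact LimitIdentification`. -/
theorem BulkScalingLimitExists_of_subs (h1 : RatioPrecompact) (h2 : LimitIdentification) :
    Summit.CriticalPhenomena.SAWScalingLimit.Theses.SAWQuarterTwist.BulkScalingLimitExists :=
  bulkScalingLimitExists_iff.mp (bulkScalingLimitExists'_of_subs h1 h2)

/-! ### 5. Route-file-ready (fully expanded) form of `Sub₁` and its equivalence with `RatioPrecompact`

The statement a `ledger route edit --split … --into RatioPrecompact …` would write into the route file (no vocabulary
from this workfile; `children.json`), and the check that it is the same proposition up to the packaging of hypotheses. -/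

/-- `RatioPrecompact`, fully expanded over tree declarations (VERBATIM `children.json[0].signature`). -/
def RatioPrecompactExpanded : Prop :=
  ∀ (D : Literature.Probability.RandomPlanarGeometry.DobrushinDomain) (p : ℂ) (ρ : ℝ) (Λ : ℝ → Finset Literature.Probability.LatticeModels.HexVertex) (x : ℝ → Literature.Probability.LatticeModels.Site 2), let sgn : ℝ → Literature.Probability.LatticeModels.HexVertex → Literature.Probability.LatticeModels.HexVertex → ℤ := fun s p q => if q.2 = 0 ∧ p.2 = 1 ∧ p.1 = q.1 - Pi.single 1 1 ∧ q.1 1 = x s 1 ∧ x s 0 ≤ q.1 0 then 1 else if p.2 = 0 ∧ q.2 = 1 ∧ q.1 = p.1 - Pi.single 1 1 ∧ p.1 1 = x s 1 ∧ x s 0 ≤ p.1 0 then -1 else 0; let a : ℝ → Sym2 Literature.Probability.LatticeModels.HexVertex := fun s => s((x s - Pi.single 0 1, (0 : Fin 2)), (x s - Pi.single 0 1 - Pi.single 1 1, (1 : Fin 2))); let F : ℝ → Sym2 Literature.Probability.LatticeModels.HexVertex → ℂ := fun s z => ∑ γ : Literature.Probability.RandomPlanarGeometry.SAW.HexMidEdgeSAW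 (Λ s) (a s) z, γ.weight Literature.Probability.RandomPlanarGeometry.SAW.hexCriticalFugacity (5 / 8) * Complex.I ^ ((γ.verts.zip γ.verts.tail).map (fun pq => sgn s pq.1 pq.2)).sum; let P : (ℂ → ℂ) → ℝ → ℂ := fun ψ δ => ∑ᶠ e ∈ Literature.Probability.RandomPlanarGeometry.SAW.hexDomainMidEdges (Λ δ), ψ ((δ : ℂ) * Literature.Probability.RandomPlanarGeometry.SAW.hexMidpoint e) * F δ e; let Bulk : (ℂ → ℂ) → Prop := fun ψ => Continuous ψ ∧ HasCompactSupport ψ ∧ tsupport ψ ⊆ D.carrier \ {p}; p ∈ D.carrier → 0 < ρ → Metric.ball p ρ ⊆ D.carrier → (∀ᶠ δ : ℝ in nhdsWithin 0 (Set.Ioi 0), Literature.Probability.RandomPlanarGeometry.SAW.hexDomainSimplyConnected (Λ δ) ∧ (Literature.Probability.LatticeModels.hexGraph.induce ((Λ δ : Finset Literature.Probability.LatticeModels.HexVertex) : Set Literature.Probability.LatticeModels.HexVertex)).Preconnected ∧ (∀ v ∈ Λ δ, (δ : ℂ) * Literature.Probability.LatticeModels.hexCenter v ∈ D.carrier) ∧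 (∀ v : Literature.Probability.LatticeModels.HexVertex, (δ : ℂ) * Literature.Probability.LatticeModels.hexCenter v ∈ Metric.ball p ρ → v ∈ Λ δ)) → (∀ K : Set ℂ, IsCompact K → K ⊆ D.carrier → ∀ᶠ δ : ℝ in nhdsWithin 0 (Set.Ioi 0), ∀ v : Literature.Probability.LatticeModels.HexVertex, (δ : ℂ) * Literature.Probability.LatticeModels.hexCenter v ∈ K → v ∈ Λ δ) → Filter.Tendsto (fun δ : ℝ => (δ : ℂ) * Literature.Probability.LatticeModels.triEmbed (x δ)) (nhdsWithin 0 (Set.Ioi 0)) (nhds p) → ∃ ψ₀ : ℂ → ℂ, (Bulk ψ₀ ∧ (∀ᶠ δ : ℝ in nhdsWithin 0 (Set.Ioi 0), P ψ₀ δ ≠ 0) ∧ ∀ ψ : ℂ → ℂ, Bulk ψ → ∃ C : ℝ, ∀ᶠ δ : ℝ in nhdsWithin 0 (Set.Ioi 0), ‖P ψ δ‖ ≤ C * ‖P ψ₀ δ‖) ∧ ∀ u : ℕ → ℝ, Filter.Tendsto u Filter.atTop (nhdsWithin 0 (Set.Ioi 0)) → ∃ φ : ℕ → ℕ, StrictMono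 φ ∧ ∃ L : (ℂ → ℂ) → ℂ, ∀ ψ : ℂ → ℂ, Bulk ψ → Filter.Tendsto (fun k => P ψ (u (φ k)) / P ψ₀ (u (φ k))) Filter.atTop (nhds (L ψ))

/-- The expanded form is `RatioPrecompact` (curried hypotheses versus the `Admissible` conjunction; the rest is
definitional). -/
theorem ratioPrecompactExpanded_iff : RatioPrecompactExpanded ↔ RatioPrecompact := by
  constructor
  · rintro h D p ρ Λ x ⟨hp, hρ, hb, hΛ, hK, hx⟩
    exact h D p ρ Λ x hp hρ hb hΛ hK hx
  · intro h D p ρ Λ x sgn' a' F' P' Bulk' hp hρ hb hΛ hK hx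
    exact h D p ρ Λ x ⟨hp, hρ, hb, hΛ, hK, hx⟩

/-! ### 4. The converse direction `crux → Sub₂` needs the anchor's domination and is recorded informally in
`Lines/birth.md`; `crux → (anchor part of Sub₁)` likewise.  Not needed for the split. -/

end Summit.CriticalPhenomena.SAWScalingLimit.Cruxes.BulkScalingLimitExists.Strategist

end
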